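import Literature.NumberTheory.Transcendental.PeriodsWave0
import Literature.NumberTheory.Transcendental.RoyCriterion

/-!
# Schanuel / RoyCriterion — Schanuel in rank one from Hermite–Lindemann

Route `Schanuel/RoyCriterion`, item `stmt-Schanuel-0466` (sanity crux): the named fact
`Literature.NumberTheory.Transcendental.transcendental_exp` (Hermite–Lindemann: `α ≠ 0` algebraic ⇒ `e^α` transcendental)
gives Schanuel's conjecture for rank `1` in Roy's format `Literature.Transcend.SchanuelRank 1`. This
validates the `SchanuelRank` encoding of `RoyCriterion.lean` and, with `Roy2001_iff`, yields
`RoyCriterion 1` conditionally.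
-/

noncomputable section

open Complex

namespace Literature.Transcend

/-- Settles `stmt-Schanuel-0466`: Hermite–Lindemann (`Literature.NumberTheory.Transcendental.transcendental_exp`, taken as a
hypothesis) implies Schanuel's conjecture for rank `1`: if `y ≠ 0` then one of `y`, `e^y` is
transcendental, so `trdeg_ℚ ℚ(y, e^y) ≥ 1`. [folklore] -/
theorem schanuelRank_one_of_transcendental_exp :
    Literature.NumberTheory.Transcendental.transcendental_exp → Literature.NumberTheory.Transcendental.SchanuelRank 1 := by
  intro hHL y hy
  have hy0 : y 0 ≠ 0 := hy.ne_zero 0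
  set K := IntermediateField.adjoin ℚ (Set.range y ∪ Set.range (cexp ∘ y)) with hK
  have key : ∃ t : ℂ, t ∈ K ∧ Transcendental ℚ t := by
    by_cases halg : IsAlgebraic ℚ (y 0)
    · exact ⟨cexp (y 0), IntermediateField.subset_adjoin _ _ (Or.inr ⟨0, rfl⟩), hHL halg hy0⟩
    · exact ⟨y 0, IntermediateField.subset_adjoin _ _ (Or.inl ⟨0, rfl⟩), halg⟩
  obtain ⟨t, htK, ht⟩ := key
  haveI : Algebra.Transcendental ℚ K :=
    ⟨⟨⟨t, htK⟩, fun h => ht (IntermediateField.isAlgebraic_iff.mp h)⟩⟩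
  have h := trdeg_pos ℚ K
  rw [← Cardinal.one_le_iff_pos] at h
  simpa using h

/-- Corollary (conditional form of `stmt-Schanuel-0465`): Roy's equivalence for rank `1` and
Hermite–Lindemann give Roy's criterion in rank one. [folklore] -/
theorem royCriterion_one_of_facts :
    Literature.NumberTheory.Transcendental.Roy2001_iff → Literature.NumberTheory.Transcendental.transcendental_exp → Literature.NumberTheory.Transcendental.RoyCriterion 1 :=
  fun h hHL => (h 1).mpr (schanuelRank_one_of_transcendental_exp hHL)

end Literature.Transcend

end
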